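import Literature.InformationTheory.Entanglement.QuantumFisherInformationSumBound
import HarnessLib

/-!
# `F_Q[ρ, J_l] ≤ (N−1)² + 1` and `Σ_l F_Q[ρ, J_l] ≤ N² + 1` for biseparable states: the quantum Fisher
# information as a witness of genuine multipartite entanglement (Tóth 2012 eqs. (bisep-1), (bisep); Hyllus et
# al. 2012; Tóth–Apellaniz § 5.3)

Hodge foundations lane (`lit-hodgefound`, prover p24 gen 79; quantum-information series, file 6).  THEOREMS
ONLY: no definition, no named fact, net debt 0.  Vocabulary: the `N`-qubit register `Fin N → Bool`
(`localPauli`, `collectiveSpin`, `variance`, `vecState` of `SpinSqueezingCriterion.lean` / `TsirelsonBound.lean`),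
the cut formalism `tensorAcross A a b`, `IsBiseparablePure`, `IsBiseparable` of `GHZFidelityWitness.lean`
(BF Definition 18.4 / 18.5: genuinely multipartite entangled := not biseparable), the block spins
`spinIn A l = Σ_{i∈A} σ_l^{(i)}`, `spinOut A l = Σ_{i∉A} σ_l^{(i)}` and the cut calculus of
`UnentangledSpinsBound.lean`, and the SLD data of the g78/g79 `StateDiscrimination` files
(`Tρ + ρT = i(ρJ − Jρ)`, `F_Q[ρ, J] = 2Tr(T · i(ρJ − Jρ))`).

## Sources (read verbatim)

* G. Tóth, Phys. Rev. A **85** (2012) 022322 [Toth2012MultipartiteMetrology], p. 3: «A pure state is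
  biseparable if it can be written as a tensor product of two multi-partite states [AB01]. A mixed state is
  biseparable if it can be written as a mixture of biseprable pure states. The bounds for biseparable states
  for the left-hand-side of Eqs. (Nka-2) and (Nka) can be obtained from Observation 3 and 4 after taking
  `n = 1` and maximizing the bounds in those Observations over `k = ⌈N/2⌉, …, N−1` … Hence, we obtain
  `F_Q[ϱ, J_l] ≤ (N−1)² + 1` (bisep-1), `Σ_{l=x,y,z} F_Q[ϱ, J_l] ≤ N² + 1` (bisep).  Any state that violates
  Eq. (bisep-1) or Eq. (bisep) is genuine multipartite entangled.»  Proof of Observation 3 (§3): «based on using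
  `(ΔJ_l)²_{|ψ_m^{(N_m)}⟩} ≤ N_m²/4` for the `N_m`-qubit units, we obtain `(ΔJ_l)²_{|ψ_{k-producible}⟩} =
  Σ_m (ΔJ_l)²_{|ψ_m⟩} ≤ Σ_m N_m²/4`»; proof of Observation 4: «`Σ_l (ΔJ_l)²_{k-prod} = Σ_m Σ_l (ΔJ_l)²_{|ψ_m⟩} ≤
  Σ_m N_m(N_m+2)/4` … We have to use that for pure states of `N ≥ 2` qubits, we have `Σ_l (ΔJ_l)² ≤ N(N+2)/4`,
  while for `N = 1` we have a better bound `Σ_l (ΔJ_l)² ≤ ½`.»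
* G. Tóth, I. Apellaniz, J. Phys. A **47** (2014) 424006 [TothApellaniz2014], §5.3: «For `N`-qubit
  `k`-producible states, the quantum Fisher information is bounded from above by `F_Q[ϱ,J_l] ≤ sk² + (N−sk)²`
  … It is also instructive to find bounds for genuine `N`-particle entanglement … Hence, we arrive at
  `F_Q[ϱ,J_l] ≤ (N−1)² + 1` … Any state that violates eq. (bisep-1) or eq. (bisep) is genuine multipartite
  entangled.»; §3.2: «A pure state is biseparable, if it can be written as `|Ψ⟩ = |Ψ₁⟩ ⊗ |Ψ₂⟩`. A mixed state
  is biseparable if it can be written as a mixture of biseparable pure states. A state that is not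
  biseparable, is genuine multipartite entangled.»

## What is formalized (all PROVED)

§ 1 The cut decomposition of the variance for a unit product vector `ψ = a ⊗_A b`:
`spinIn_mul_spinOut_comm` (`P_lQ_l = Q_lP_l`), `dot_localPauli_in_out` / `dot_spinIn_spinOut` (no
correlations across the cut: `⟨P_lQ_l⟩ = ⟨P_l⟩⟨Q_l⟩`), **`four_variance_collectiveSpin_tensorAcross`**
(`4(ΔJ_l)²_ψ = (ΔP_l)²_ψ + (ΔQ_l)²_ψ`).
§ 2 Block Loewner bounds `−|A|·𝟙 ≤ Σ_{i∈A} σ_l^{(i)} ≤ |A|·𝟙` (`le_spinIn`, `spinIn_le`) and, through the g79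
variance bound `QFIVariance.variance_le_sq_div_four`, **`variance_spinIn_le_card_sq`** (`(ΔP_l)²_ψ ≤ |A|²` in
every unit vector state), `variance_spinOut_le_card_sq`.
§ 3 **`four_variance_collectiveSpin_le_of_tensorAcross`** (`4(ΔJ_l)² ≤ |A|² + (N−|A|)² ≤ (N−1)² + 1` for a
unit product across a proper cut), `qfi_le_of_isBiseparablePure`.
§ 4 **`qfi_le_of_isBiseparable`** (Tóth (bisep-1) / TA §5.3: `F_Q[ρ, J_l] ≤ (N−1)² + 1` for every biseparable
`ρ` and every Hermitian SLD, by `QuantumFisherInformationConvexity.qfi_convex`), the GME criterion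
**`not_isBiseparable_of_qfi_gt`**, and its non-vacuity **`biseparable_bound_lt_qfi_ghzN`**
(`(N−1)² + 1 < N² = F_Q[GHZ_N, J_z]` for `N ≥ 2`; with `not_isBiseparable_of_qfi_gt` this re-derives
`GHZWitness.not_isBiseparable_ghzN` by the metrological route).

§ 5 The sum criterion (bisep): the block Casimir bound **`blockCasimir_posSemidef`**
(`Σ_l (Σ_{i∈A}σ_l^{(i)})² ≤ |A|(|A|+2)·𝟙`, from `QFISumBound.one_sub_exchange_posSemidef`), `sum_vecState_spinIn_sq_le`,
`sum_variance_spinIn_le` (`Σ_l (ΔP_l)² ≤ |A|(|A|+2)`); the single-qubit refinement **`sum_variance_spinIn_singleton`** /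
`sum_variance_spinOut_singleton` (`Σ_l (Δσ_l^{(i)})² = 2` for a one-qubit block of a product with unit factors, via
a one-site Bloch-sphere identity transported to `Bool`); `exists_unit_factors` (unit biseparable pure states have
unit factors); **`four_sum_variance_le_of_tensorAcross`** (`4Σ_l (ΔJ_l)² ≤ N² + 1`, cases `|A| = 1`, `|Ā| = 1`,
both `≥ 2`), `four_sum_variance_le_of_isBiseparablePure`; the per-direction convexity lemma
**`qfi_mixture_le_sum_four_variance`** (`F_Q[Σ p_k|ψ_k⟩⟨ψ_k|, H] ≤ Σ_k p_k 4(ΔH)²_{ψ_k}`, any Hermitian `H`);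
**`sum_qfi_le_of_isBiseparable`** (Tóth (bisep): `Σ_l F_Q[ρ, J_l] ≤ N² + 1`) and **`not_isBiseparable_of_sum_qfi_gt`**.

NOT formalized: the general `k`-producibility bounds (Observations 3–4: a product over an arbitrary partition
is not in the tree's vocabulary), optimality of `(N−1)² + 1` and `N² + 1`.
Tree search (FAIL-DUP, 2026-09-01): `rg -n "IsBiseparable" Literature/InformationTheory/Entanglement` → fidelity /
stabilizer / matrix-element GME witnesses (`GHZFidelityWitness`, `GHZStabilizerWitness`,
`GHZMatrixElementCriterion`, `WStateWitness`, `DickeStateWitness`, `GraphStateStabilizerWitness`); no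
QFI-based GME bound; `spinIn`/`spinOut`/`tensorAcross` calculus reused from `UnentangledSpinsBound.lean`.
-/

noncomputable section

open scoped BigOperators ComplexOrder ComplexConjugate
open Matrix Complex Finset
open Literature.Computability.QuantumComplexity
open Literature.InformationTheory.Entanglement.Tsirelson
open Literature.InformationTheory.StateDiscrimination

namespace Literature.InformationTheory.Entanglement

namespace QFIBiseparable

open SpinSqueezing GHZWitness MerminKlyshkoGHZ UnentangledSpins QFICriterion QFISumBound

variable {N : ℕ}

/-! ## § 1 The variance of `J_l` in a product vector across a cut -/

/-- **The two parts of `2J_l` commute**: `P_lQ_l = Q_lP_l` (`P_l = Σ_{i∈A}σ_l^{(i)}`, `Q_l = Σ_{j∉A}σ_l^{(j)}`;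
distinct sites commute). [cite: Toth2012MultipartiteMetrology, §3 (proof of Observation 3: `J_l = Σ_n J_l^{(n)}`
over the blocks)] -/
theorem spinIn_mul_spinOut_comm (A : Finset (Fin N)) (l : Pauli) :
    spinIn A l * spinOut A l = spinOut A l * spinIn A l := by
  rw [spinIn, spinOut, Finset.sum_mul_sum, Finset.sum_mul_sum, Finset.sum_comm]
  refine Finset.sum_congr rfl fun i hi => Finset.sum_congr rfl fun j hj => ?_
  have hji : j ≠ i := by
    rintro rfl
    exact (Finset.mem_compl.mp hi) hj
  exact localPauli_mul_comm hji l l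

section Cut

variable {A : Finset (Fin N)} {a : ({i // i ∈ A} → Bool) → ℂ} {b : ({i // i ∉ A} → Bool) → ℂ}

/-- **No correlations across a product cut**, for local Paulis: with `ψ = a ⊗_A b` a unit vector, `i ∈ A`,
`j ∉ A`: `⟨ψ, σ_l^{(i)}σ_m^{(j)}ψ⟩ = ⟨ψ, σ_l^{(i)}ψ⟩⟨ψ, σ_m^{(j)}ψ⟩` (only `⟨a ⊗ b, a ⊗ b⟩ = 1` is used, not the
normalisation of the two factors separately). [cite: Toth2012MultipartiteMetrology, §3 (proof of Observation
3)] [cite: TothApellaniz2014, §3.2 eq. (`|Ψ⟩ = |Ψ₁⟩ ⊗ |Ψ₂⟩`)] -/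
theorem dot_localPauli_in_out {i j : Fin N} (hi : i ∈ A) (hj : j ∉ A) (l m : Pauli)
    (hψ : star (tensorAcross A a b) ⬝ᵥ tensorAcross A a b = 1) :
    star (tensorAcross A a b) ⬝ᵥ (localPauli l i *ᵥ (localPauli m j *ᵥ tensorAcross A a b)) =
      (star (tensorAcross A a b) ⬝ᵥ (localPauli l i *ᵥ tensorAcross A a b)) *
        (star (tensorAcross A a b) ⬝ᵥ (localPauli m j *ᵥ tensorAcross A a b)) := by
  rw [star_tensorAcross_dotProduct] at hψ
  rw [localPauli, localPauli, pauliWord_mulVec_tensorAcross, pauliWord_mulVec_tensorAcross,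
    pauliWord_mulVec_tensorAcross, pauliWordOn_in_eq_one (localWord_in hj m),
    pauliWordOn_out_eq_one (localWord_out hi l), one_mulVec, one_mulVec, one_mulVec,
    star_tensorAcross_dotProduct, star_tensorAcross_dotProduct, star_tensorAcross_dotProduct,
    mul_assoc _ (star b ⬝ᵥ b), ← mul_assoc (star b ⬝ᵥ b) (star a ⬝ᵥ a), mul_comm (star b ⬝ᵥ b) (star a ⬝ᵥ a),
    hψ, one_mul]

/-- **`⟨P_lQ_l⟩_ψ = ⟨P_l⟩_ψ⟨Q_l⟩_ψ`** in a unit product vector `ψ = a ⊗_A b`. [cite: Toth2012MultipartiteMetrology,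
§3 (proof of Observation 3)] -/
theorem dot_spinIn_spinOut (hψ : star (tensorAcross A a b) ⬝ᵥ tensorAcross A a b = 1) (l : Pauli) :
    star (tensorAcross A a b) ⬝ᵥ (spinIn A l *ᵥ (spinOut A l *ᵥ tensorAcross A a b)) =
      (star (tensorAcross A a b) ⬝ᵥ (spinIn A l *ᵥ tensorAcross A a b)) *
        (star (tensorAcross A a b) ⬝ᵥ (spinOut A l *ᵥ tensorAcross A a b)) := by
  rw [spinIn, spinOut]
  simp_rw [Matrix.sum_mulVec, Matrix.mulVec_sum, dotProduct_sum]
  rw [Finset.sum_mul_sum]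
  refine Finset.sum_congr rfl fun i hi => Finset.sum_congr rfl fun j hj => ?_
  exact dot_localPauli_in_out hi (Finset.mem_compl.mp hj) l l hψ

/-- **The cut decomposition of the variance**: for a unit product vector `ψ = a ⊗_A b`,
`4(ΔJ_l)²_ψ = (ΔP_l)²_ψ + (ΔQ_l)²_ψ` — «the variance of the collective observable is the sum of the variances»
of the two blocks, the cross terms cancelling by `⟨P_lQ_l⟩ = ⟨P_l⟩⟨Q_l⟩`. [cite: Toth2012MultipartiteMetrology,
§3 (proof of Observation 3)] -/
theorem four_variance_collectiveSpin_tensorAcross (hψ : star (tensorAcross A a b) ⬝ᵥ tensorAcross A a b = 1)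
    (l : Pauli) :
    4 * variance (tensorAcross A a b) (collectiveSpin l N) =
      variance (tensorAcross A a b) (spinIn A l) + variance (tensorAcross A a b) (spinOut A l) := by
  generalize hψ' : tensorAcross A a b = ψ
  have hP : star ψ ⬝ᵥ (spinIn A l *ᵥ ψ) = ((vecState ψ (spinIn A l) : ℝ) : ℂ) :=
    star_dotProduct_mulVec_of_isHermitian (spinIn_isHermitian A l) ψ
  have hQ : star ψ ⬝ᵥ (spinOut A l *ᵥ ψ) = ((vecState ψ (spinOut A l) : ℝ) : ℂ) :=
    star_dotProduct_mulVec_of_isHermitian (spinOut_isHermitian A l) ψ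
  have hPQ : vecState ψ (spinIn A l * spinOut A l) = vecState ψ (spinIn A l) * vecState ψ (spinOut A l) := by
    rw [vecState_apply ψ (spinIn A l * spinOut A l), ← mulVec_mulVec, ← hψ', dot_spinIn_spinOut hψ l, hψ', hP, hQ,
      ← Complex.ofReal_mul, Complex.ofReal_re]
  have hQP : vecState ψ (spinOut A l * spinIn A l) = vecState ψ (spinIn A l) * vecState ψ (spinOut A l) := by
    rw [← spinIn_mul_spinOut_comm, hPQ]
  rw [variance, variance, variance, collectiveSpin_eq A, smul_mul_assoc, mul_smul_comm, smul_smul, map_smul,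
    map_smul, smul_eq_mul, smul_eq_mul, add_mul, mul_add, mul_add, map_add, map_add, map_add, map_add, hPQ, hQP]
  ring

end Cut

/-! ## § 2 Block Loewner bounds and `(ΔP_l)² ≤ |A|²` -/

/-- `0 ≤ 2` in the star order of `ℂ`. [folklore] -/
private theorem two_nonneg : (0 : ℂ) ≤ (2 : ℂ) := by
  rw [show (2 : ℂ) = ((2 : ℝ) : ℂ) by norm_num]
  exact Complex.zero_le_real.mpr (by norm_num)

/-- `𝟙 + σ_l^{(i)} ⪰ 0`. [folklore] -/
private theorem posSemidef_one_add_localPauli (l : Pauli) (i : Fin N) :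
    ((1 : Matrix (Fin N → Bool) (Fin N → Bool) ℂ) + localPauli l i).PosSemidef := by
  have h := (posSemidef_half_one_add_localPauli l i).smul two_nonneg
  rwa [smul_smul, show (2 : ℂ) * (1 / 2) = 1 by norm_num, one_smul] at h

/-- `𝟙 − σ_l^{(i)} ⪰ 0`. [folklore] -/
private theorem posSemidef_one_sub_localPauli (l : Pauli) (i : Fin N) :
    ((1 : Matrix (Fin N → Bool) (Fin N → Bool) ℂ) - localPauli l i).PosSemidef := by
  have h := (posSemidef_half_one_sub_localPauli l i).smul two_nonneg
  rwa [smul_smul, show (2 : ℂ) * (1 / 2) = 1 by norm_num, one_smul] at h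

/-- Finite sums of positive semidefinite matrices are positive semidefinite. [folklore] -/
private theorem posSemidef_sum {ι m : Type*} [Fintype m] (s : Finset ι) {M : ι → Matrix m m ℂ}
    (h : ∀ k ∈ s, (M k).PosSemidef) : (∑ k ∈ s, M k).PosSemidef :=
  Finset.sum_induction M (fun X => X.PosSemidef) (fun _ _ ha hb => ha.add hb) PosSemidef.zero h

/-- **`Σ_{i∈A} σ_l^{(i)} ≤ |A|·𝟙`**: `|A|·𝟙 − P_l = Σ_{i∈A}(𝟙 − σ_l^{(i)}) ⪰ 0` (the block analogue of
`J_l ≤ (N/2)𝟙`). [cite: Toth2012MultipartiteMetrology, §3 (proof of Observation 3, `F_Q ≤ Σ_n N_n²`)] -/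
theorem spinIn_le (A : Finset (Fin N)) (l : Pauli) :
    ((((A.card : ℝ)) : ℂ) • (1 : Matrix (Fin N → Bool) (Fin N → Bool) ℂ) - spinIn A l).PosSemidef := by
  have e : (((A.card : ℝ)) : ℂ) • (1 : Matrix (Fin N → Bool) (Fin N → Bool) ℂ) - spinIn A l =
      ∑ i ∈ A, ((1 : Matrix (Fin N → Bool) (Fin N → Bool) ℂ) - localPauli l i) := by
    rw [spinIn, Finset.sum_sub_distrib, Finset.sum_const, ← Nat.cast_smul_eq_nsmul ℂ, Complex.ofReal_natCast]
  rw [e]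
  exact posSemidef_sum A fun i _ => posSemidef_one_sub_localPauli l i

/-- **`−|A|·𝟙 ≤ Σ_{i∈A} σ_l^{(i)}`**: `P_l + |A|·𝟙 = Σ_{i∈A}(𝟙 + σ_l^{(i)}) ⪰ 0`. [cite: Toth2012MultipartiteMetrology,
§3 (proof of Observation 3)] -/
theorem le_spinIn (A : Finset (Fin N)) (l : Pauli) :
    (spinIn A l - ((-(A.card : ℝ) : ℝ) : ℂ) • (1 : Matrix (Fin N → Bool) (Fin N → Bool) ℂ)).PosSemidef := by
  have e : spinIn A l - ((-(A.card : ℝ) : ℝ) : ℂ) • (1 : Matrix (Fin N → Bool) (Fin N → Bool) ℂ) =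
      ∑ i ∈ A, ((1 : Matrix (Fin N → Bool) (Fin N → Bool) ℂ) + localPauli l i) := by
    rw [spinIn, Finset.sum_add_distrib, Finset.sum_const, ← Nat.cast_smul_eq_nsmul ℂ, Complex.ofReal_neg,
      Complex.ofReal_natCast, neg_smul, sub_neg_eq_add, add_comm]
  rw [e]
  exact posSemidef_sum A fun i _ => posSemidef_one_add_localPauli l i

/-- `Tr(|ψ⟩⟨ψ| M) = ⟨ψ|M|ψ⟩`. [folklore] -/
private theorem trState_vecMulVec (ψ : (Fin N → Bool) → ℂ) (M : Matrix (Fin N → Bool) (Fin N → Bool) ℂ) :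
    trState (vecMulVec ψ (star ψ)) M = vecState ψ M := by
  rw [trState_apply, vecState_apply, Matrix.trace_mul_comm, Matrix.mul_vecMulVec, Matrix.trace_vecMulVec,
    dotProduct_comm]

/-- **`(ΔP_l)²_ψ ≤ |A|²`** in every unit vector state: a Hermitian `P` with `−|A|·𝟙 ≤ P ≤ |A|·𝟙` has variance at
most `(2|A|)²/4` (`QFIVariance.variance_le_sq_div_four`, applied to `ρ = |ψ⟩⟨ψ|`) — the block's «`F_Q ≤ N_n²`».
[cite: Toth2012MultipartiteMetrology, §3 (proof of Observation 3)] [cite: TothApellaniz2014, §5.3 eq. (Nka-2)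
(`s k² + (N − sk)²`)] -/
theorem variance_spinIn_le_card_sq {ψ : (Fin N → Bool) → ℂ} (hψ : star ψ ⬝ᵥ ψ = 1) (A : Finset (Fin N))
    (l : Pauli) : variance ψ (spinIn A l) ≤ (A.card : ℝ) ^ 2 := by
  have hρ : (vecMulVec ψ (star ψ)).PosSemidef := posSemidef_vecMulVec_self_star ψ
  have hρ1 : (vecMulVec ψ (star ψ)).trace = 1 := by rw [trace_vecMulVec, dotProduct_comm, hψ]
  have h := QFIVariance.variance_le_sq_div_four hρ hρ1 (spinIn_isHermitian A l) (le_spinIn A l) (spinIn_le A l)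
  rw [← trState_apply, ← trState_apply, trState_vecMulVec, trState_vecMulVec] at h
  have e : ((A.card : ℝ) - -(A.card : ℝ)) ^ 2 / 4 = (A.card : ℝ) ^ 2 := by ring
  rw [variance, ← e]
  exact h

/-- `(ΔQ_l)²_ψ ≤ |Ā|²` (`Q_l = Σ_{i∉A}σ_l^{(i)}` is the block spin of `Ā`). [cite: Toth2012MultipartiteMetrology,
§3 (proof of Observation 3)] -/
theorem variance_spinOut_le_card_sq {ψ : (Fin N → Bool) → ℂ} (hψ : star ψ ⬝ᵥ ψ = 1) (A : Finset (Fin N))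
    (l : Pauli) : variance ψ (spinOut A l) ≤ (Aᶜ.card : ℝ) ^ 2 :=
  variance_spinIn_le_card_sq hψ Aᶜ l

/-! ## § 3 Pure biseparable states: `F_Q[a ⊗ b, J_l] ≤ |A|² + (N − |A|)² ≤ (N−1)² + 1` -/

/-- The maximisation over the cut: for `1 ≤ k ≤ N − 1`, `k² + (N−k)² ≤ (N−1)² + 1` («maximizing the bounds …
over `k = ⌈N/2⌉, …, N−1`»). [cite: Toth2012MultipartiteMetrology, p. 3 (before (bisep-1))] -/
theorem sq_add_sq_le {k N : ℕ} (h1 : 1 ≤ k) (h2 : k + 1 ≤ N) :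
    (k : ℝ) ^ 2 + ((N : ℝ) - k) ^ 2 ≤ ((N : ℝ) - 1) ^ 2 + 1 := by
  have hk : (1 : ℝ) ≤ k := by exact_mod_cast h1
  have hN : (k : ℝ) + 1 ≤ N := by exact_mod_cast h2
  nlinarith [mul_nonneg (sub_nonneg.mpr hk) (sub_nonneg.mpr hN)]

section Pure

variable {A : Finset (Fin N)} {a : ({i // i ∈ A} → Bool) → ℂ} {b : ({i // i ∉ A} → Bool) → ℂ}

/-- **Pure product across a proper cut**: for a unit `ψ = a ⊗_A b` with `A ≠ ∅`, `Ā ≠ ∅`: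
`4(ΔJ_l)²_ψ = (ΔP_l)² + (ΔQ_l)² ≤ |A|² + (N−|A|)² ≤ (N−1)² + 1`. [cite: Toth2012MultipartiteMetrology, §3 and
p. 3 eq. (bisep-1)] [cite: TothApellaniz2014, §5.3 eq. (bisep-1)] -/
theorem four_variance_collectiveSpin_le_of_tensorAcross (hA : A.Nonempty) (hAc : Aᶜ.Nonempty)
    (hψ : star (tensorAcross A a b) ⬝ᵥ tensorAcross A a b = 1) (l : Pauli) :
    4 * variance (tensorAcross A a b) (collectiveSpin l N) ≤ ((N : ℝ) - 1) ^ 2 + 1 := by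
  rw [four_variance_collectiveSpin_tensorAcross hψ l]
  have hcard : (Aᶜ.card : ℝ) = (N : ℝ) - A.card := by
    rw [Finset.card_compl, Fintype.card_fin, Nat.cast_sub (A.card_le_univ.trans_eq (Fintype.card_fin N))]
  have h1 : 1 ≤ A.card := Finset.card_pos.mpr hA
  have h2 : A.card + 1 ≤ N := by
    have := Finset.card_pos.mpr hAc
    rw [Finset.card_compl, Fintype.card_fin] at this
    omega
  calc variance (tensorAcross A a b) (spinIn A l) + variance (tensorAcross A a b) (spinOut A l)
      ≤ (A.card : ℝ) ^ 2 + (Aᶜ.card : ℝ) ^ 2 :=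
        add_le_add (variance_spinIn_le_card_sq hψ A l) (variance_spinOut_le_card_sq hψ A l)
    _ ≤ ((N : ℝ) - 1) ^ 2 + 1 := by rw [hcard]; exact sq_add_sq_le h1 h2

end Pure

/-- **`F_Q[ψ, J_l] ≤ (N−1)² + 1` for every unit biseparable pure state** and every Hermitian SLD `S` of
`P = |ψ⟩⟨ψ|` along `J_l` (pure states: `F_Q = 4(ΔJ_l)²`). [cite: Toth2012MultipartiteMetrology, p. 3 eq. (bisep-1)]
[cite: TothApellaniz2014, §5.3 eq. (bisep-1)] -/
theorem qfi_le_of_isBiseparablePure (l : Pauli) {ψ : (Fin N → Bool) → ℂ} (hbs : IsBiseparablePure ψ)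
    (hψ : star ψ ⬝ᵥ ψ = 1) {S : Matrix (Fin N → Bool) (Fin N → Bool) ℂ} (hS : S.IsHermitian)
    (hSP : S * vecMulVec ψ (star ψ) + vecMulVec ψ (star ψ) * S =
      Complex.I • (vecMulVec ψ (star ψ) * collectiveSpin l N - collectiveSpin l N * vecMulVec ψ (star ψ))) :
    (2 * (S * (Complex.I • (vecMulVec ψ (star ψ) * collectiveSpin l N -
        collectiveSpin l N * vecMulVec ψ (star ψ)))).trace).re ≤ ((N : ℝ) - 1) ^ 2 + 1 := by
  rw [qfi_pure_eq_four_variance (collectiveSpin_isHermitian l N) hS hψ hSP]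
  obtain ⟨A, hA, hAc, a, b, rfl⟩ := hbs
  exact four_variance_collectiveSpin_le_of_tensorAcross hA hAc hψ l

/-! ## § 4 Biseparable mixed states and the GME criterion -/

/-- **Tóth (bisep-1) / Tóth–Apellaniz § 5.3: `F_Q[ρ, J_l] ≤ (N−1)² + 1` for every biseparable `N`-qubit state**
(a mixture of unit pure states each a product across some proper cut, BF 18.3.1 (ii)) and every Hermitian SLD
`T` of `ρ` along `J_l`.  Road: the pure bound § 3 and the convexity of the QFI
(`QuantumFisherInformationConvexity.qfi_convex`, each component with its SLD `Ŝ_k = ρ̇_k`). [cite: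
Toth2012MultipartiteMetrology, p. 3 eq. (bisep-1)] [cite: TothApellaniz2014, §5.3 eq. (bisep-1)] -/
theorem qfi_le_of_isBiseparable (l : Pauli) {ρ : Matrix (Fin N → Bool) (Fin N → Bool) ℂ} (hρ : IsBiseparable ρ)
    {T : Matrix (Fin N → Bool) (Fin N → Bool) ℂ} (hT : T.IsHermitian)
    (hTρ : T * ρ + ρ * T = Complex.I • (ρ * collectiveSpin l N - collectiveSpin l N * ρ)) :
    (2 * (T * (Complex.I • (ρ * collectiveSpin l N - collectiveSpin l N * ρ))).trace).re ≤
      ((N : ℝ) - 1) ^ 2 + 1 := by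
  obtain ⟨ι, _, p, ψ, hp, h1, hψ1, hbs, rfl⟩ := hρ
  have hJh : (collectiveSpin l N).IsHermitian := collectiveSpin_isHermitian l N
  -- the pure components `P_k = |ψ_k⟩⟨ψ_k|` and their SLDs `S_k = ρ̇_k`
  obtain ⟨P, hP⟩ : ∃ P : ι → Matrix (Fin N → Bool) (Fin N → Bool) ℂ, P = fun k => vecMulVec (ψ k) (star (ψ k)) :=
    ⟨_, rfl⟩
  obtain ⟨S, hS⟩ : ∃ S : ι → Matrix (Fin N → Bool) (Fin N → Bool) ℂ,
      S = fun k => Complex.I • (P k * collectiveSpin l N - collectiveSpin l N * P k) := ⟨_, rfl⟩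
  have hPk' : ∀ k, vecMulVec (ψ k) (star (ψ k)) = P k := fun k => by rw [hP]
  simp_rw [hPk'] at hTρ ⊢
  have hPk : ∀ k, (P k).PosSemidef := fun k => by rw [hP]; exact posSemidef_vecMulVec_self_star (ψ k)
  have hSk : ∀ k, (S k).IsHermitian := fun k => by
    rw [hS]; exact QFIVariance.unitaryDeriv_isHermitian (hPk k).1 hJh
  have hSP : ∀ k, S k * P k + P k * S k = S k := fun k => by
    rw [hS, hP]; exact sld_vecMulVec hJh (hψ1 k)
  have hSk' : ∀ k, Complex.I • (P k * collectiveSpin l N - collectiveSpin l N * P k) = S k := fun k => by rw [hS]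
  -- linearity: `Σ p_k ρ̇_k = ρ̇`
  have e : ∑ k, ((p k : ℝ) : ℂ) • (S k * P k + P k * S k) =
      Complex.I • ((∑ k, ((p k : ℝ) : ℂ) • P k) * collectiveSpin l N -
        collectiveSpin l N * ∑ k, ((p k : ℝ) : ℂ) • P k) := by
    simp_rw [hSP, ← hSk']
    rw [Finset.sum_mul, Finset.mul_sum, ← Finset.sum_sub_distrib, Finset.smul_sum]
    refine sum_congr rfl fun k _ => ?_
    rw [smul_mul_assoc, mul_smul_comm, ← smul_sub, smul_comm]
  have hsld : T * (∑ k, ((p k : ℝ) : ℂ) • P k) + (∑ k, ((p k : ℝ) : ℂ) • P k) * T =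
      ∑ k, ((p k : ℝ) : ℂ) • (S k * P k + P k * S k) := by rw [e]; exact hTρ
  have hconv := QFIConvexity.qfi_convex hp hPk hSk hT hsld
  rw [e] at hconv
  have htwo : ∀ z : ℂ, (2 * z).re = 2 * z.re := fun z => by
    simp only [Complex.mul_re, Complex.re_ofNat, Complex.im_ofNat, zero_mul, sub_zero]
  -- each component: `2Tr(S_k ρ̇_k) ≤ (N−1)² + 1`
  have hcomp : ∀ k, 2 * (S k * (S k * P k + P k * S k)).trace.re ≤ ((N : ℝ) - 1) ^ 2 + 1 := by
    intro k
    have h := qfi_le_of_isBiseparablePure l (hbs k) (hψ1 k) (S := S k) (hSk k) (by rw [hPk', hSk']; exact hSP k)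
    rw [hPk', hSk', htwo] at h
    rwa [hSP k]
  rw [htwo]
  calc 2 * (T * (Complex.I • ((∑ k, ((p k : ℝ) : ℂ) • P k) * collectiveSpin l N -
          collectiveSpin l N * ∑ k, ((p k : ℝ) : ℂ) • P k))).trace.re
      ≤ ∑ k, p k * (2 * (S k * (S k * P k + P k * S k)).trace.re) := hconv
    _ ≤ ∑ k, p k * (((N : ℝ) - 1) ^ 2 + 1) := sum_le_sum fun k _ => mul_le_mul_of_nonneg_left (hcomp k) (hp k)
    _ = ((N : ℝ) - 1) ^ 2 + 1 := by rw [← Finset.sum_mul, h1, one_mul]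

/-- **The QFI criterion for genuine multipartite entanglement** («Any state that violates Eq. (bisep-1) … is
genuine multipartite entangled»): a Hermitian SLD `T` along `J_l` with `2Tr(Tρ̇) > (N−1)² + 1` certifies that
`ρ` is not biseparable. [cite: Toth2012MultipartiteMetrology, p. 3 (after (bisep))] [cite: TothApellaniz2014,
§5.3 (after (bisep))] -/
theorem not_isBiseparable_of_qfi_gt (l : Pauli) {ρ T : Matrix (Fin N → Bool) (Fin N → Bool) ℂ}
    (hT : T.IsHermitian) (hTρ : T * ρ + ρ * T = Complex.I • (ρ * collectiveSpin l N - collectiveSpin l N * ρ))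
    (hgt : ((N : ℝ) - 1) ^ 2 + 1 <
      (2 * (T * (Complex.I • (ρ * collectiveSpin l N - collectiveSpin l N * ρ))).trace).re) :
    ¬ IsBiseparable ρ :=
  fun hρ => absurd (qfi_le_of_isBiseparable l hρ hT hTρ) (not_le.mpr hgt)

/-- **The criterion is not vacuous: the GHZ state violates it** — for `N ≥ 2` and every Hermitian SLD `S` of
`|GHZ_N⟩⟨GHZ_N|` along `J_z`, `(N−1)² + 1 < N² = F_Q[GHZ_N, J_z]` (`QFICriterion.qfi_ghzN_eq_sq`); with
`not_isBiseparable_of_qfi_gt` this is the metrological road to `GHZWitness.not_isBiseparable_ghzN` («To reach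
the maximal phase sensitivity, genuine multipartite entanglement is needed»). [cite:
Toth2012MultipartiteMetrology, p. 3 (after (bisep)) and Observation 2 (GHZ saturation)] [cite: TothApellaniz2014,
§5.3] -/
theorem biseparable_bound_lt_qfi_ghzN (h2 : 2 ≤ N) {S : Matrix (Fin N → Bool) (Fin N → Bool) ℂ}
    (hS : S.IsHermitian)
    (hSP : S * vecMulVec (ghzN N) (star (ghzN N)) + vecMulVec (ghzN N) (star (ghzN N)) * S =
      Complex.I • (vecMulVec (ghzN N) (star (ghzN N)) * collectiveSpin Pauli.Z N -
        collectiveSpin Pauli.Z N * vecMulVec (ghzN N) (star (ghzN N)))) :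
    ((N : ℝ) - 1) ^ 2 + 1 <
      (2 * (S * (Complex.I • (vecMulVec (ghzN N) (star (ghzN N)) * collectiveSpin Pauli.Z N -
        collectiveSpin Pauli.Z N * vecMulVec (ghzN N) (star (ghzN N))))).trace).re := by
  have : NeZero N := ⟨by omega⟩
  rw [qfi_ghzN_eq_sq hS hSP]
  have h2' : (2 : ℝ) ≤ N := by exact_mod_cast h2
  nlinarith

/-! ## § 5 The sum criterion (bisep): `Σ_l F_Q[ρ, J_l] ≤ N² + 1` for biseparable states -/

/-! ### The block Casimir bound `Σ_l P_l² ≤ |A|(|A|+2)·𝟙` -/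

/-- `Σ_l P_l² = Σ_{i∈A}Σ_{j∈A} T_{ij}` with `T_{ij} = Σ_l σ_l^{(i)}σ_l^{(j)}`. [cite: Toth2012MultipartiteMetrology, §3
(proof of Observation 4: «using Eq. (all) for the `k`-qubit units»)] -/
theorem sum_spinIn_sq_eq (A : Finset (Fin N)) :
    spinIn A Pauli.X * spinIn A Pauli.X + spinIn A Pauli.Y * spinIn A Pauli.Y + spinIn A Pauli.Z * spinIn A Pauli.Z =
      ∑ i ∈ A, ∑ j ∈ A, (localPauli Pauli.X i * localPauli Pauli.X j + localPauli Pauli.Y i * localPauli Pauli.Y j +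
        localPauli Pauli.Z i * localPauli Pauli.Z j) := by
  simp only [spinIn, Finset.sum_mul_sum, ← Finset.sum_add_distrib]

/-- **The Casimir bound of a block** («Eq. (all) for the `k`-qubit units»): `Σ_l (Σ_{i∈A}σ_l^{(i)})² ≤ |A|(|A|+2)·𝟙`,
i.e. `4Σ_l (J_l^A)² ≤ 4·j(j+1)𝟙` with `j = |A|/2`, as the PSD decomposition `¼Σ_{i≠j∈A}(𝟙 − T_{ij})` of
`QFISumBound.casimir_posSemidef` restricted to the block. [cite: Toth2012MultipartiteMetrology, §3 (proof of
Observation 4) with §2 eq. (ineq-1)] -/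
theorem blockCasimir_posSemidef (A : Finset (Fin N)) :
    ((((A.card : ℝ) * (A.card + 2) : ℝ) : ℂ) • (1 : Matrix (Fin N → Bool) (Fin N → Bool) ℂ) -
      (spinIn A Pauli.X * spinIn A Pauli.X + spinIn A Pauli.Y * spinIn A Pauli.Y +
        spinIn A Pauli.Z * spinIn A Pauli.Z)).PosSemidef := by
  rw [sum_spinIn_sq_eq]
  obtain ⟨T, hT⟩ : ∃ T : Fin N → Fin N → Matrix (Fin N → Bool) (Fin N → Bool) ℂ, T = fun i j =>
      localPauli Pauli.X i * localPauli Pauli.X j + localPauli Pauli.Y i * localPauli Pauli.Y j +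
        localPauli Pauli.Z i * localPauli Pauli.Z j := ⟨_, rfl⟩
  have hT' : ∀ i j, localPauli Pauli.X i * localPauli Pauli.X j + localPauli Pauli.Y i * localPauli Pauli.Y j +
      localPauli Pauli.Z i * localPauli Pauli.Z j = T i j := fun i j => by rw [hT]
  simp_rw [hT']
  have hdiag : ∀ i : Fin N, T i i = (3 : ℂ) • 1 := fun i => by
    have h1 : ∀ l : Pauli, localPauli l i * localPauli l i = 1 := fun l => pauliWord_mul_self _
    rw [← hT', h1, h1, h1]; module
  have hoff : ∀ i j : Fin N, i ≠ j → (1 - T i j).PosSemidef := fun i j hij => by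
    rw [← hT']; exact one_sub_exchange_posSemidef hij
  have key : (((A.card : ℝ) * (A.card + 2) : ℝ) : ℂ) • (1 : Matrix (Fin N → Bool) (Fin N → Bool) ℂ) -
      ∑ i ∈ A, ∑ j ∈ A, T i j =
      ∑ i ∈ A, ∑ j ∈ A, (if i = j then (0 : Matrix (Fin N → Bool) (Fin N → Bool) ℂ) else 1 - T i j) := by
    have hS : ∀ i j : Fin N, (if i = j then (0 : Matrix (Fin N → Bool) (Fin N → Bool) ℂ) else 1 - T i j) =
        (1 - T i j) + (if i = j then (2 : ℂ) • (1 : Matrix (Fin N → Bool) (Fin N → Bool) ℂ) else 0) := by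
      intro i j
      by_cases h : i = j
      · subst h; rw [if_pos rfl, if_pos rfl, hdiag]; module
      · rw [if_neg h, if_neg h, add_zero]
    simp_rw [hS]
    have h2 : ∀ i ∈ A, ∑ j ∈ A, ((1 - T i j) +
        (if i = j then (2 : ℂ) • (1 : Matrix (Fin N → Bool) (Fin N → Bool) ℂ) else 0)) =
        ∑ j ∈ A, (1 - T i j) + (2 : ℂ) • (1 : Matrix (Fin N → Bool) (Fin N → Bool) ℂ) := by
      intro i hi
      rw [Finset.sum_add_distrib, Finset.sum_ite_eq, if_pos hi]
    rw [Finset.sum_congr rfl h2, Finset.sum_add_distrib]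
    simp only [Finset.sum_sub_distrib, Finset.sum_const, ← Nat.cast_smul_eq_nsmul ℂ, smul_smul]
    push_cast
    module
  rw [key]
  refine posSemidef_sum A fun i _ => posSemidef_sum A fun j _ => ?_
  by_cases h : i = j
  · rw [if_pos h]; exact PosSemidef.zero
  · rw [if_neg h]; exact hoff i j h

/-- **`Σ_l ⟨P_l²⟩_ψ ≤ |A|(|A|+2)`** in every unit vector state. [cite: Toth2012MultipartiteMetrology, §3 (proof of
Observation 4: «for pure states of `N ≥ 2` qubits, we have `Σ_l (ΔJ_l)² ≤ N(N+2)/4`» applied to a block)] -/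
theorem sum_vecState_spinIn_sq_le {ψ : (Fin N → Bool) → ℂ} (hψ : star ψ ⬝ᵥ ψ = 1) (A : Finset (Fin N)) :
    vecState ψ (spinIn A Pauli.X * spinIn A Pauli.X) + vecState ψ (spinIn A Pauli.Y * spinIn A Pauli.Y) +
        vecState ψ (spinIn A Pauli.Z * spinIn A Pauli.Z) ≤ (A.card : ℝ) * (A.card + 2) := by
  have hρ : (vecMulVec ψ (star ψ)).PosSemidef := posSemidef_vecMulVec_self_star ψ
  have h := Literature.LinearAlgebra.Matrix.re_trace_mul_nonneg_of_posSemidef hρ (blockCasimir_posSemidef A)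
  rw [Matrix.mul_sub, Matrix.mul_smul, Matrix.mul_one, trace_sub, trace_smul, trace_vecMulVec, dotProduct_comm, hψ,
    smul_eq_mul, mul_one, Complex.sub_re, Complex.ofReal_re, ← trState_apply, map_add, map_add, trState_vecMulVec,
    trState_vecMulVec, trState_vecMulVec] at h
  linarith

/-- **`Σ_l (ΔP_l)²_ψ ≤ |A|(|A|+2)`** (the block of `|A| ≥ 2` qubits; valid for every block). [cite:
Toth2012MultipartiteMetrology, §3 (proof of Observation 4)] -/
theorem sum_variance_spinIn_le {ψ : (Fin N → Bool) → ℂ} (hψ : star ψ ⬝ᵥ ψ = 1) (A : Finset (Fin N)) :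
    variance ψ (spinIn A Pauli.X) + variance ψ (spinIn A Pauli.Y) + variance ψ (spinIn A Pauli.Z) ≤
      (A.card : ℝ) * (A.card + 2) := by
  have h := sum_vecState_spinIn_sq_le hψ A
  simp only [variance]
  nlinarith [sq_nonneg (vecState ψ (spinIn A Pauli.X)), sq_nonneg (vecState ψ (spinIn A Pauli.Y)),
    sq_nonneg (vecState ψ (spinIn A Pauli.Z))]

/-! ### A single-qubit block: `Σ_l (Δσ_l)² = 2` («for `N = 1` we have a better bound `Σ_l (ΔJ_l)² ≤ ½`») -/

/-- On a one-site register `S = {s₀}`, a Pauli word acts as its single letter: `⟨a, (⊗_{s∈S}σ_{w_s}) a⟩ =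
⟨φ, σ_{w_{s₀}} φ⟩` with `φ(v) = a(s ↦ v)`. [folklore] -/
private theorem single_site_dot {S : Type*} [Fintype S] [DecidableEq S] (s0 : S) (hS : ∀ s, s = s0)
    (w : S → Pauli) (a : (S → Bool) → ℂ) :
    star a ⬝ᵥ (pauliWordOn w *ᵥ a) =
      star (fun v : Bool => a (fun _ => v)) ⬝ᵥ ((w s0).mat *ᵥ fun v : Bool => a (fun _ => v)) := by
  haveI : Subsingleton S := ⟨fun x y => (hS x).trans (hS y).symm⟩
  have hx : ∀ x : S → Bool, (fun _ : S => x s0) = x := fun x => funext fun s => by rw [hS s]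
  let e : (S → Bool) ≃ Bool := ⟨fun x => x s0, fun v _ => v, fun x => hx x, fun _ => rfl⟩
  have he : ∀ x : S → Bool, e x = x s0 := fun x => rfl
  simp only [dotProduct, Matrix.mulVec, Pi.star_apply, pauliWordOn_apply, Fintype.prod_subsingleton _ s0]
  refine Fintype.sum_equiv e _ _ fun x => ?_
  rw [he, Fintype.sum_equiv e (fun y : S → Bool => (w s0).mat (x s0) (y s0) * a y)
    (fun u : Bool => (w s0).mat (x s0) u * a (fun _ => u)) fun y => by rw [he, hx]]
  rw [hx]

/-- **A pure qubit has `⟨σ_x⟩² + ⟨σ_y⟩² + ⟨σ_z⟩² = 1`**, on a one-site register. [cite: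
Toth2012MultipartiteMetrology, §3 (proof of Observation 4: «for `N = 1` we have a better bound
`Σ_l (ΔJ_l)² ≤ ½`»)] -/
private theorem single_site_bloch_sum {S : Type*} [Fintype S] [DecidableEq S] (s0 : S) (hS : ∀ s, s = s0)
    (a : (S → Bool) → ℂ) (ha : star a ⬝ᵥ a = 1) :
    (star a ⬝ᵥ (pauliWordOn (fun _ : S => Pauli.X) *ᵥ a)).re ^ 2 +
        (star a ⬝ᵥ (pauliWordOn (fun _ : S => Pauli.Y) *ᵥ a)).re ^ 2 +
        (star a ⬝ᵥ (pauliWordOn (fun _ : S => Pauli.Z) *ᵥ a)).re ^ 2 = 1 := by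
  have hφ : star (fun v : Bool => a (fun _ => v)) ⬝ᵥ (fun v : Bool => a (fun _ => v)) = 1 := by
    have h := single_site_dot s0 hS (fun _ => Pauli.I) a
    rw [pauliWordOn_const_I, one_mulVec, ha, show Pauli.I.mat = (1 : Matrix Bool Bool ℂ) from rfl,
      one_mulVec] at h
    exact h.symm
  have hb := bloch_sq_sum _ hφ
  rw [bloch, bloch, bloch] at hb
  rw [single_site_dot s0 hS, single_site_dot s0 hS, single_site_dot s0 hS]
  exact hb

section SingleIn

variable {i : Fin N} {a : ({j // j ∈ ({i} : Finset (Fin N))} → Bool) → ℂ}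
  {b : ({j // j ∉ ({i} : Finset (Fin N))} → Bool) → ℂ}

/-- **A single-qubit block `A = {i}` in a product `a ⊗ b` (unit factors) has `Σ_l (Δσ_l^{(i)})² = 2`**, i.e.
`Σ_l (Δj_l)² = ½` («for `N = 1` we have a better bound»): the block's state is the pure qubit `a`, and
`⟨σ_x⟩² + ⟨σ_y⟩² + ⟨σ_z⟩² = 1`. [cite: Toth2012MultipartiteMetrology, §3 (proof of Observation 4)] -/
theorem sum_variance_spinIn_singleton (ha : star a ⬝ᵥ a = 1) (hb : star b ⬝ᵥ b = 1) :
    variance (tensorAcross {i} a b) (spinIn {i} Pauli.X) + variance (tensorAcross {i} a b) (spinIn {i} Pauli.Y) +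
      variance (tensorAcross {i} a b) (spinIn {i} Pauli.Z) = 2 := by
  have hψ : star (tensorAcross {i} a b) ⬝ᵥ tensorAcross {i} a b = 1 := by
    rw [star_tensorAcross_dotProduct, ha, hb, mul_one]
  have hmem : i ∈ ({i} : Finset (Fin N)) := Finset.mem_singleton_self i
  have hw : ∀ l : Pauli,
      (fun j : {j // j ∈ ({i} : Finset (Fin N))} => Function.update (fun _ : Fin N => Pauli.I) i l j) = fun _ => l := by
    intro l; funext j
    have hj : (j : Fin N) = i := Finset.mem_singleton.mp j.2
    rw [hj, Function.update_self]
  have hex : ∀ l : Pauli, star (tensorAcross {i} a b) ⬝ᵥ (localPauli l i *ᵥ tensorAcross {i} a b) =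
      star a ⬝ᵥ (pauliWordOn (fun _ => l) *ᵥ a) := by
    intro l
    rw [localPauli, dot_word_in (localWord_out hmem l) hb, hw]
  have hsq : ∀ l : Pauli, localPauli l i * localPauli l i = 1 := fun l => pauliWord_mul_self _
  have hone : vecState (tensorAcross {i} a b) 1 = 1 := by rw [vecState_one, hψ, Complex.one_re]
  have hs1 : ∀ l, spinIn ({i} : Finset (Fin N)) l = localPauli l i := fun l => by rw [spinIn, Finset.sum_singleton]
  have key := single_site_bloch_sum (S := {j // j ∈ ({i} : Finset (Fin N))}) ⟨i, hmem⟩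
    (fun t => Subtype.ext (Finset.mem_singleton.mp t.2)) a ha
  rw [hs1, hs1, hs1, variance, variance, variance, hsq, hsq, hsq, hone, vecState_apply, vecState_apply,
    vecState_apply, hex, hex, hex]
  linarith

end SingleIn

section SingleOut

variable {A : Finset (Fin N)} {a : ({j // j ∈ A} → Bool) → ℂ} {b : ({j // j ∉ A} → Bool) → ℂ} {i : Fin N}

/-- The same for a single-qubit block on the other side of the cut (`Ā = {i}`): `Σ_l (Δσ_l^{(i)})² = 2`. [cite:
Toth2012MultipartiteMetrology, §3 (proof of Observation 4)] -/
theorem sum_variance_spinOut_singleton (hAc : Aᶜ = {i}) (ha : star a ⬝ᵥ a = 1) (hb : star b ⬝ᵥ b = 1) :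
    variance (tensorAcross A a b) (spinOut A Pauli.X) + variance (tensorAcross A a b) (spinOut A Pauli.Y) +
      variance (tensorAcross A a b) (spinOut A Pauli.Z) = 2 := by
  have hψ : star (tensorAcross A a b) ⬝ᵥ tensorAcross A a b = 1 := by
    rw [star_tensorAcross_dotProduct, ha, hb, mul_one]
  have hout : ∀ j : Fin N, j ∉ A → j = i := fun j hj => by
    have h := Finset.mem_compl.mpr hj
    rw [hAc] at h
    exact Finset.mem_singleton.mp h
  have hi : i ∉ A := by
    have h : i ∈ Aᶜ := by rw [hAc]; exact Finset.mem_singleton_self i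
    exact Finset.mem_compl.mp h
  have hw : ∀ l : Pauli,
      (fun j : {j // j ∉ A} => Function.update (fun _ : Fin N => Pauli.I) i l j) = fun _ => l := by
    intro l; funext j
    rw [hout j j.2, Function.update_self]
  have hex : ∀ l : Pauli, star (tensorAcross A a b) ⬝ᵥ (localPauli l i *ᵥ tensorAcross A a b) =
      star b ⬝ᵥ (pauliWordOn (fun _ => l) *ᵥ b) := by
    intro l
    rw [localPauli, pauliWord_mulVec_tensorAcross, pauliWordOn_in_eq_one (localWord_in hi l), one_mulVec,
      star_tensorAcross_dotProduct, ha, one_mul, hw]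
  have hsq : ∀ l : Pauli, localPauli l i * localPauli l i = 1 := fun l => pauliWord_mul_self _
  have hone : vecState (tensorAcross A a b) 1 = 1 := by rw [vecState_one, hψ, Complex.one_re]
  have hs1 : ∀ l, spinOut A l = localPauli l i := fun l => by rw [spinOut, hAc, Finset.sum_singleton]
  have key := single_site_bloch_sum (S := {j // j ∉ A}) ⟨i, hi⟩ (fun t => Subtype.ext (hout t t.2)) b hb
  rw [hs1, hs1, hs1, variance, variance, variance, hsq, hsq, hsq, hone, vecState_apply, vecState_apply,
    vecState_apply, hex, hex, hex]
  linarith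

end SingleOut

/-! ### Unit factors, and the bound for pure biseparable states -/

/-- A unit biseparable pure state has a product form with BOTH factors unit vectors (rescale `a ↦ a/‖a‖`,
`b ↦ ‖a‖b`). [cite: TothApellaniz2014, §3.2 («`|Ψ⟩ = |Ψ₁⟩ ⊗ |Ψ₂⟩`»)] -/
theorem exists_unit_factors {ψ : (Fin N → Bool) → ℂ} (hbs : IsBiseparablePure ψ) (hψ : star ψ ⬝ᵥ ψ = 1) :
    ∃ A : Finset (Fin N), A.Nonempty ∧ Aᶜ.Nonempty ∧
      ∃ (a : ({i // i ∈ A} → Bool) → ℂ) (b : ({i // i ∉ A} → Bool) → ℂ),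
        star a ⬝ᵥ a = 1 ∧ star b ⬝ᵥ b = 1 ∧ ψ = tensorAcross A a b := by
  obtain ⟨A, hA, hAc, a, b, rfl⟩ := hbs
  rw [star_tensorAcross_dotProduct] at hψ
  obtain ⟨hre, him⟩ := Complex.nonneg_iff.mp (dotProduct_star_self_nonneg a)
  have hna : star a ⬝ᵥ a = ((star a ⬝ᵥ a).re : ℂ) :=
    Complex.ext (by rw [Complex.ofReal_re]) (by rw [Complex.ofReal_im, ← him])
  generalize hr : (star a ⬝ᵥ a).re = r at hre hna
  rw [hna] at hψ
  have hr0 : r ≠ 0 := by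
    rintro rfl
    rw [Complex.ofReal_zero, zero_mul] at hψ
    exact zero_ne_one hψ
  have hrpos : 0 < r := lt_of_le_of_ne hre (Ne.symm hr0)
  have hs0 : Real.sqrt r ≠ 0 := (Real.sqrt_pos.mpr hrpos).ne'
  have hss : Real.sqrt r * Real.sqrt r = r := Real.mul_self_sqrt hrpos.le
  refine ⟨A, hA, hAc, (((Real.sqrt r)⁻¹ : ℝ) : ℂ) • a, ((Real.sqrt r : ℝ) : ℂ) • b, ?_, ?_, ?_⟩
  · have hinv : (Real.sqrt r)⁻¹ * (Real.sqrt r)⁻¹ * r = 1 :=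
      calc (Real.sqrt r)⁻¹ * (Real.sqrt r)⁻¹ * r = (Real.sqrt r)⁻¹ * (Real.sqrt r)⁻¹ * (Real.sqrt r * Real.sqrt r) := by
            rw [hss]
        _ = ((Real.sqrt r)⁻¹ * Real.sqrt r) * ((Real.sqrt r)⁻¹ * Real.sqrt r) := by ring
        _ = 1 := by rw [inv_mul_cancel₀ hs0, one_mul]
    rw [star_smul, smul_dotProduct, dotProduct_smul, smul_smul, hna, Complex.star_def, Complex.conj_ofReal,
      smul_eq_mul, ← Complex.ofReal_mul, ← Complex.ofReal_mul, hinv, Complex.ofReal_one]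
  · rw [star_smul, smul_dotProduct, dotProduct_smul, smul_smul, Complex.star_def, Complex.conj_ofReal, smul_eq_mul,
      ← Complex.ofReal_mul, hss]
    exact hψ
  · funext x
    rw [tensorAcross_apply, tensorAcross_apply, Pi.smul_apply, Pi.smul_apply, smul_eq_mul, smul_eq_mul]
    have hc : (((Real.sqrt r)⁻¹ : ℝ) : ℂ) * ((Real.sqrt r : ℝ) : ℂ) = 1 := by
      rw [← Complex.ofReal_mul, inv_mul_cancel₀ hs0, Complex.ofReal_one]
    linear_combination (-(a (restrictIn A x) * b (restrictOut A x))) * hc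

section PureSum

variable {A : Finset (Fin N)} {a : ({i // i ∈ A} → Bool) → ℂ} {b : ({i // i ∉ A} → Bool) → ℂ}

/-- **Pure product across a proper cut, the sum of the three variances**: `4Σ_l (ΔJ_l)²_{a⊗b} = Σ_l (ΔP_l)² +
Σ_l (ΔQ_l)² ≤ N² + 1` — blocks of `≥ 2` qubits bounded by `k(k+2)`, a single-qubit block contributing `2`, and
the maximum over `k = |A|` («The maximum … is obtained if all but a single state has `k` qubits»). [cite:
Toth2012MultipartiteMetrology, §3 (proof of Observation 4) and p. 3 eq. (bisep)] [cite: TothApellaniz2014, §5.3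
eq. (bisep)] -/
theorem four_sum_variance_le_of_tensorAcross (hA : A.Nonempty) (hAc : Aᶜ.Nonempty) (ha : star a ⬝ᵥ a = 1)
    (hb : star b ⬝ᵥ b = 1) :
    4 * variance (tensorAcross A a b) (collectiveSpin Pauli.X N) +
        4 * variance (tensorAcross A a b) (collectiveSpin Pauli.Y N) +
        4 * variance (tensorAcross A a b) (collectiveSpin Pauli.Z N) ≤ (N : ℝ) ^ 2 + 1 := by
  have hψ : star (tensorAcross A a b) ⬝ᵥ tensorAcross A a b = 1 := by
    rw [star_tensorAcross_dotProduct, ha, hb, mul_one]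
  rw [four_variance_collectiveSpin_tensorAcross hψ Pauli.X, four_variance_collectiveSpin_tensorAcross hψ Pauli.Y,
    four_variance_collectiveSpin_tensorAcross hψ Pauli.Z]
  have hcard : (Aᶜ.card : ℝ) = (N : ℝ) - A.card := by
    rw [Finset.card_compl, Fintype.card_fin, Nat.cast_sub (A.card_le_univ.trans_eq (Fintype.card_fin N))]
  have hk1 : 1 ≤ A.card := Finset.card_pos.mpr hA
  have hkc1 : 1 ≤ Aᶜ.card := Finset.card_pos.mpr hAc
  have hP := sum_variance_spinIn_le hψ A
  have hQ : variance (tensorAcross A a b) (spinOut A Pauli.X) + variance (tensorAcross A a b) (spinOut A Pauli.Y) +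
      variance (tensorAcross A a b) (spinOut A Pauli.Z) ≤ (Aᶜ.card : ℝ) * (Aᶜ.card + 2) :=
    sum_variance_spinIn_le hψ Aᶜ
  by_cases h1 : A.card = 1
  · obtain ⟨i, rfl⟩ := Finset.card_eq_one.mp h1
    have hP1 := sum_variance_spinIn_singleton (i := i) ha hb
    have hk : ((({i} : Finset (Fin N)).card : ℕ) : ℝ) = 1 := by rw [Finset.card_singleton, Nat.cast_one]
    rw [hk] at hcard
    rw [hcard] at hQ
    nlinarith [hP1, hQ]
  · by_cases h2 : Aᶜ.card = 1
    · obtain ⟨i, hi⟩ := Finset.card_eq_one.mp h2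
      have hQ1 := sum_variance_spinOut_singleton hi ha hb
      have hk : (A.card : ℝ) = (N : ℝ) - 1 := by
        have : ((Aᶜ.card : ℕ) : ℝ) = 1 := by rw [h2, Nat.cast_one]
        linarith
      rw [hk] at hP
      nlinarith [hQ1, hP]
    · have hk2 : (2 : ℝ) ≤ A.card := by exact_mod_cast (show 2 ≤ A.card by omega)
      have hkc2 : (2 : ℝ) ≤ Aᶜ.card := by exact_mod_cast (show 2 ≤ Aᶜ.card by omega)
      nlinarith [mul_nonneg (sub_nonneg.mpr hk2) (sub_nonneg.mpr hkc2), hP, hQ, hcard]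

end PureSum

/-- **`Σ_l F_Q[ψ, J_l] = 4Σ_l (ΔJ_l)²_ψ ≤ N² + 1` for every unit biseparable pure state.** [cite:
Toth2012MultipartiteMetrology, p. 3 eq. (bisep)] [cite: TothApellaniz2014, §5.3 eq. (bisep)] -/
theorem four_sum_variance_le_of_isBiseparablePure {ψ : (Fin N → Bool) → ℂ} (hbs : IsBiseparablePure ψ)
    (hψ : star ψ ⬝ᵥ ψ = 1) :
    4 * variance ψ (collectiveSpin Pauli.X N) + 4 * variance ψ (collectiveSpin Pauli.Y N) +
      4 * variance ψ (collectiveSpin Pauli.Z N) ≤ (N : ℝ) ^ 2 + 1 := by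
  obtain ⟨A, hA, hAc, a, b, ha, hb, rfl⟩ := exists_unit_factors hbs hψ
  exact four_sum_variance_le_of_tensorAcross hA hAc ha hb

/-! ### Mixtures: convexity per direction -/

/-- **Convexity of the QFI over a pure-state decomposition**: for `ρ = Σ_k p_k|ψ_k⟩⟨ψ_k|` (unit `ψ_k`, `p_k ≥ 0`),
a Hermitian `H` and every Hermitian SLD `T` of `ρ` along `H`: `F_Q[ρ, H] ≤ Σ_k p_k F_Q[ψ_k, H] = Σ_k p_k 4(ΔH)²_{ψ_k}`
(`QuantumFisherInformationConvexity.qfi_convex` with the pure SLDs `Ŝ_k = ρ̇_k`, and `F_Q = 4(ΔH)²` on pure states).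
[cite: Toth2012MultipartiteMetrology, §2 («`F[ϱ,J_l]` is convex in the state» and «For a pure state `ϱ`, we have
`F[ϱ,J_l] = 4(ΔJ_l)²_ϱ`»)] -/
theorem qfi_mixture_le_sum_four_variance {ι : Type*} [Fintype ι] {p : ι → ℝ} (hp : ∀ k, 0 ≤ p k)
    {ψ : ι → (Fin N → Bool) → ℂ} (hψ : ∀ k, star (ψ k) ⬝ᵥ ψ k = 1)
    {H : Matrix (Fin N → Bool) (Fin N → Bool) ℂ} (hH : H.IsHermitian)
    {ρ T : Matrix (Fin N → Bool) (Fin N → Bool) ℂ} (hρ : ρ = ∑ k, (p k : ℂ) • vecMulVec (ψ k) (star (ψ k)))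
    (hT : T.IsHermitian) (hTρ : T * ρ + ρ * T = Complex.I • (ρ * H - H * ρ)) :
    (2 * (T * (Complex.I • (ρ * H - H * ρ))).trace).re ≤ ∑ k, p k * (4 * variance (ψ k) H) := by
  subst hρ
  obtain ⟨P, hP⟩ : ∃ P : ι → Matrix (Fin N → Bool) (Fin N → Bool) ℂ, P = fun k => vecMulVec (ψ k) (star (ψ k)) :=
    ⟨_, rfl⟩
  obtain ⟨S, hS⟩ : ∃ S : ι → Matrix (Fin N → Bool) (Fin N → Bool) ℂ,
      S = fun k => Complex.I • (P k * H - H * P k) := ⟨_, rfl⟩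
  have hPk' : ∀ k, vecMulVec (ψ k) (star (ψ k)) = P k := fun k => by rw [hP]
  simp_rw [hPk'] at hTρ ⊢
  have hPk : ∀ k, (P k).PosSemidef := fun k => by rw [hP]; exact posSemidef_vecMulVec_self_star (ψ k)
  have hSk : ∀ k, (S k).IsHermitian := fun k => by
    rw [hS]; exact QFIVariance.unitaryDeriv_isHermitian (hPk k).1 hH
  have hSP : ∀ k, S k * P k + P k * S k = S k := fun k => by
    rw [hS, hP]; exact sld_vecMulVec hH (hψ k)
  have hSk' : ∀ k, Complex.I • (P k * H - H * P k) = S k := fun k => by rw [hS]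
  have e : ∑ k, ((p k : ℝ) : ℂ) • (S k * P k + P k * S k) =
      Complex.I • ((∑ k, ((p k : ℝ) : ℂ) • P k) * H - H * ∑ k, ((p k : ℝ) : ℂ) • P k) := by
    simp_rw [hSP, ← hSk']
    rw [Finset.sum_mul, Finset.mul_sum, ← Finset.sum_sub_distrib, Finset.smul_sum]
    refine sum_congr rfl fun k _ => ?_
    rw [smul_mul_assoc, mul_smul_comm, ← smul_sub, smul_comm]
  have hsld : T * (∑ k, ((p k : ℝ) : ℂ) • P k) + (∑ k, ((p k : ℝ) : ℂ) • P k) * T =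
      ∑ k, ((p k : ℝ) : ℂ) • (S k * P k + P k * S k) := by rw [e]; exact hTρ
  have hconv := QFIConvexity.qfi_convex hp hPk hSk hT hsld
  rw [e] at hconv
  have htwo : ∀ z : ℂ, (2 * z).re = 2 * z.re := fun z => by
    simp only [Complex.mul_re, Complex.re_ofNat, Complex.im_ofNat, zero_mul, sub_zero]
  have hcomp : ∀ k, 2 * (S k * (S k * P k + P k * S k)).trace.re = 4 * variance (ψ k) H := by
    intro k
    have h := qfi_pure_eq_four_variance hH (hSk k) (hψ k) (S := S k) (by rw [hPk', hSk']; exact hSP k)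
    rw [hPk', hSk', htwo] at h
    rw [hSP k, h, variance, vecState_apply, vecState_apply]
  rw [htwo]
  calc 2 * (T * (Complex.I • ((∑ k, ((p k : ℝ) : ℂ) • P k) * H - H * ∑ k, ((p k : ℝ) : ℂ) • P k))).trace.re
      ≤ ∑ k, p k * (2 * (S k * (S k * P k + P k * S k)).trace.re) := hconv
    _ = ∑ k, p k * (4 * variance (ψ k) H) := by simp_rw [hcomp]

/-- **Tóth (bisep) / Tóth–Apellaniz § 5.3: `F_Q[ρ, J_x] + F_Q[ρ, J_y] + F_Q[ρ, J_z] ≤ N² + 1` for every biseparable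
`N`-qubit state** and every triple of Hermitian SLDs along `J_x, J_y, J_z`. [cite: Toth2012MultipartiteMetrology,
p. 3 eq. (bisep)] [cite: TothApellaniz2014, §5.3 eq. (bisep)] -/
theorem sum_qfi_le_of_isBiseparable {ρ : Matrix (Fin N → Bool) (Fin N → Bool) ℂ} (hρ : IsBiseparable ρ)
    {Tx Ty Tz : Matrix (Fin N → Bool) (Fin N → Bool) ℂ} (hTx : Tx.IsHermitian) (hTy : Ty.IsHermitian)
    (hTz : Tz.IsHermitian)
    (hx : Tx * ρ + ρ * Tx = Complex.I • (ρ * collectiveSpin Pauli.X N - collectiveSpin Pauli.X N * ρ))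
    (hy : Ty * ρ + ρ * Ty = Complex.I • (ρ * collectiveSpin Pauli.Y N - collectiveSpin Pauli.Y N * ρ))
    (hz : Tz * ρ + ρ * Tz = Complex.I • (ρ * collectiveSpin Pauli.Z N - collectiveSpin Pauli.Z N * ρ)) :
    (2 * (Tx * (Complex.I • (ρ * collectiveSpin Pauli.X N - collectiveSpin Pauli.X N * ρ))).trace).re +
      (2 * (Ty * (Complex.I • (ρ * collectiveSpin Pauli.Y N - collectiveSpin Pauli.Y N * ρ))).trace).re +
      (2 * (Tz * (Complex.I • (ρ * collectiveSpin Pauli.Z N - collectiveSpin Pauli.Z N * ρ))).trace).re ≤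
      (N : ℝ) ^ 2 + 1 := by
  obtain ⟨ι, _, p, ψ, hp, h1, hψ1, hbs, rfl⟩ := hρ
  have bx := qfi_mixture_le_sum_four_variance hp hψ1 (collectiveSpin_isHermitian Pauli.X N) rfl hTx hx
  have bY := qfi_mixture_le_sum_four_variance hp hψ1 (collectiveSpin_isHermitian Pauli.Y N) rfl hTy hy
  have bz := qfi_mixture_le_sum_four_variance hp hψ1 (collectiveSpin_isHermitian Pauli.Z N) rfl hTz hz
  have hk : ∀ k, p k * (4 * variance (ψ k) (collectiveSpin Pauli.X N)) +
      p k * (4 * variance (ψ k) (collectiveSpin Pauli.Y N)) + p k * (4 * variance (ψ k) (collectiveSpin Pauli.Z N)) ≤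
      p k * ((N : ℝ) ^ 2 + 1) := fun k => by
    rw [← mul_add, ← mul_add]
    exact mul_le_mul_of_nonneg_left (four_sum_variance_le_of_isBiseparablePure (hbs k) (hψ1 k)) (hp k)
  have hsum : ∑ k, p k * (4 * variance (ψ k) (collectiveSpin Pauli.X N)) +
      ∑ k, p k * (4 * variance (ψ k) (collectiveSpin Pauli.Y N)) +
      ∑ k, p k * (4 * variance (ψ k) (collectiveSpin Pauli.Z N)) ≤ (N : ℝ) ^ 2 + 1 := by
    rw [← sum_add_distrib, ← sum_add_distrib]
    calc ∑ k, (p k * (4 * variance (ψ k) (collectiveSpin Pauli.X N)) +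
          p k * (4 * variance (ψ k) (collectiveSpin Pauli.Y N)) + p k * (4 * variance (ψ k) (collectiveSpin Pauli.Z N)))
        ≤ ∑ k, p k * ((N : ℝ) ^ 2 + 1) := sum_le_sum fun k _ => hk k
      _ = (N : ℝ) ^ 2 + 1 := by rw [← Finset.sum_mul, h1, one_mul]
  linarith

/-- **The sum criterion for genuine multipartite entanglement** («Any state that violates … Eq. (bisep) is genuine
multipartite entangled»). [cite: Toth2012MultipartiteMetrology, p. 3 (after (bisep))] [cite: TothApellaniz2014,
§5.3 (after (bisep))] -/
theorem not_isBiseparable_of_sum_qfi_gt {ρ Tx Ty Tz : Matrix (Fin N → Bool) (Fin N → Bool) ℂ}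
    (hTx : Tx.IsHermitian) (hTy : Ty.IsHermitian) (hTz : Tz.IsHermitian)
    (hx : Tx * ρ + ρ * Tx = Complex.I • (ρ * collectiveSpin Pauli.X N - collectiveSpin Pauli.X N * ρ))
    (hy : Ty * ρ + ρ * Ty = Complex.I • (ρ * collectiveSpin Pauli.Y N - collectiveSpin Pauli.Y N * ρ))
    (hz : Tz * ρ + ρ * Tz = Complex.I • (ρ * collectiveSpin Pauli.Z N - collectiveSpin Pauli.Z N * ρ))
    (hgt : (N : ℝ) ^ 2 + 1 <
      (2 * (Tx * (Complex.I • (ρ * collectiveSpin Pauli.X N - collectiveSpin Pauli.X N * ρ))).trace).re +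
      (2 * (Ty * (Complex.I • (ρ * collectiveSpin Pauli.Y N - collectiveSpin Pauli.Y N * ρ))).trace).re +
      (2 * (Tz * (Complex.I • (ρ * collectiveSpin Pauli.Z N - collectiveSpin Pauli.Z N * ρ))).trace).re) :
    ¬ IsBiseparable ρ :=
  fun hρ => absurd (sum_qfi_le_of_isBiseparable hρ hTx hTy hTz hx hy hz) (not_le.mpr hgt)

end QFIBiseparable

end Literature.InformationTheory.Entanglement
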